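import Summits.ResolutionOfSingularities.ResolutionOfSingularities.Theorems.PurelyInseparableDim4ResConePureCornerDrift
import Summits.ResolutionOfSingularities.ResolutionOfSingularities.Theorems.PurelyInseparableDim4ResConePureCornerDriftFour
import Summits.ResolutionOfSingularities.ResolutionOfSingularities.Theorems.PurelyInseparableDim4ResConeCornerGame
import Summits.ResolutionOfSingularities.ResolutionOfSingularities.Theorems.PurelyInseparableDim4ResConeSatellitePair
import HarnessLib
import HarnessLib.Audit.Tags

/-!
# Purely inseparable four-folds — NO PURE-CORNER TAIL (every prime; any shade, any residual cone, any weights): an isolated witnessed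
# `Step0 p` chain cannot run for ever by corner steps `b = 0` (cell `res-dim4-pi`, K2(p) lane, B rows / rung 0 (d) «the frozen
# pure-corner regime»)

[OURS · counted 0 · cell `res-dim4-pi` · K2(p) lane (holder res-dim4-p-12 g5) · seat res-dim4-p-5 g6.]  Nothing here proves any TAIL(p, d, e),
K2(7), K2(p), `NoIsolatedTrap p p` or resolution of singularities in dimension ≥ 4 / characteristic `p` — NOT proved; a statement about OUR
frame's point-blow-up walk `Step0 p`.  AI kernel work, weaker than expert review.

THE ARGUMENT (`…ResConePureCornerDrift` + NO BIRTHS + isolation + pigeonhole).  On a pure-corner stretch every monomial of `F` moves alone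
along its formal corner trajectory (`cornerTraj j p`, the p-5 g3 definition with `d := p`: chart `i` replaces `E_i` by `|E| − p`), coefficients
unchanged, deletions only (cleaning): every monomial of `F_t` has an ANCESTOR in `F_0` whose whole trajectory is present (`pureCorner_ancestor`).
Isolation of EVERY state needs, for a chart letter `i₀`, at every time a present monomial of order `< p` along the `x_{i₀}`-axis (its `δ_{i₀} ≤ −1`);
`F_0` is finite, so ONE ancestor serves infinitely often (pigeonhole), hence is present for ever, and its axis data obey the drift dynamics of
`…PureCornerDrift` exactly — which makes all its `δ` eventually `≥ 0`: contradiction.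
* §1 `degIn_erase_chartExponent_of_ne` / `_self` — the axis sums under one corner map; `pureCorner_ancestor` — no births.
* §2 **`no_pureCorner_stretch_two` / `_three` / `_four`** — no isolated witnessed `Step0 p` chain is pure-corner from `k₁` on with its charts
  among two / three / four given letters each charted infinitely often (drift lemmas of `…PureCornerDrift`, `…PureCornerDriftFour`).
* §3 **`no_pureCorner_tail`** — NO isolated witnessed `Step0 p` chain (characteristic `p`) is pure-corner from some time on.  No hypothesis on
  shade, weights, residual cone, `e_G` or `x^{r₀} ∣ F₀` (the free-tail theorem supplies two letters charted infinitely often; letters charted finitely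
  often are discarded).  In particular (`no_translationFree_powerCone_tail`, the B-row wording) **no power-cone tail of OUR frame is eventually
  translation-free**: every tail translates a boundary or free letter at infinitely many steps — the «frozen pure-corner regime» is EMPTY.
[cite: CossartJannsenSaito2020, Lemma 13.2, Lemma 13.4, Thm. 13.7] [cite: Hauser2010, §§F–G (chart expressions of a point blowup; cleaning)]
bears_on: LADDER-RESOLUTION:D157-DOOR2 (res-dim4-pi · K2(p) B rows · no pure-corner tail; no translation-free power-cone tail).
Supports stmt-ResolutionOfSingularities-16155 (helper).
-/

set_option linter.dupNamespace false -- mandated namespace of this single-conjunct summit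

noncomputable section

namespace Summit.ResolutionOfSingularities.ResolutionOfSingularities.Theorems.PIDim4

namespace ResCone

open MvPolynomial Finset
open Literature.AlgebraicGeometry.Resolution
open Literature.AlgebraicGeometry.Resolution.CentreBlowup
open Literature.AlgebraicGeometry.Resolution.Hauser2010
open Literature.AlgebraicGeometry.Resolution.HauserPerlega2019

variable {K : Type} [Field K]

/-! ## 1. Axis sums under a corner map; no births -/

/-- Under the corner map of chart `i` (`q ≤ |E|`) the order along the `x_l`-axis, `l ≠ i`, gains the order along the `x_i`-axis minus `q`.
[folklore] -/
theorem degIn_erase_chartExponent_of_ne (q : ℕ) {i l : Fin 4} (hli : l ≠ i) {E : Fin 4 →₀ ℕ} (hq : q ≤ E.degree) :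
    degIn (Finset.univ.erase l) (chartExponent q Finset.univ i E) + q =
      degIn (Finset.univ.erase l) E + degIn (Finset.univ.erase i) E := by
  have h1 := degIn_erase_add_apply l (chartExponent q Finset.univ i E)
  have h2 := degIn_erase_add_apply l E
  have h3 := degIn_erase_add_apply i E
  have h4 := degree_chartExponent_univ q i hq
  have h5 : chartExponent q Finset.univ i E l = E l := chartExponent_apply_of_ne q _ hli E
  omega

/-- Under the corner map of chart `i` (`q ≤ |E|`) the order along the `x_i`-axis is unchanged. [folklore] -/
theorem degIn_erase_chartExponent_self (q : ℕ) (i : Fin 4) {E : Fin 4 →₀ ℕ} (hq : q ≤ E.degree) :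
    degIn (Finset.univ.erase i) (chartExponent q Finset.univ i E) = degIn (Finset.univ.erase i) E := by
  have h1 := degIn_erase_add_apply i (chartExponent q Finset.univ i E)
  have h3 := degIn_erase_add_apply i E
  have h4 := degree_chartExponent_univ q i hq
  have h5 : chartExponent q Finset.univ i E i = E.degree - q := chartExponent_univ_apply_self q i E
  omega

/-- The formal corner trajectory with `d := q` is the iterated chart exponent. [folklore] -/
theorem cornerTraj_succ_eq_chartExponent (j : ℕ → Fin 4) (q : ℕ) (E₀ : Fin 4 →₀ ℕ) (t : ℕ) :
    cornerTraj j q E₀ (t + 1) = chartExponent q Finset.univ (j t) (cornerTraj j q E₀ t) := by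
  rw [cornerTraj_succ]
  unfold chartExponent
  rw [degIn_univ]

variable [DecidableEq K]

/-- **NO BIRTHS ON A PURE-CORNER STRETCH.**  If `b k = 0` for `k ≥ k₁` on a witnessed `Step0 q` chain, every monomial of `F_{k₁ + t}` is the
position at time `t` of the corner trajectory of a monomial of `F_{k₁}` all of whose earlier positions are present. [OURS]
[cite: CossartJannsenSaito2020, Lemma 13.2] -/
theorem pureCorner_ancestor (q : ℕ) {c : ℕ → State K} {j : ℕ → Fin 4} {b : ℕ → Fin 4 → K}
    (hw : FreeTail.IsWitnessedChain q c j b) {k₁ : ℕ} (hcorner : ∀ k, k₁ ≤ k → b k = 0) (t : ℕ) :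
    ∀ E ∈ (c (k₁ + t)).F.support, ∃ E₀ ∈ (c k₁).F.support,
      (∀ t', t' ≤ t → cornerTraj (fun s => j (k₁ + s)) q E₀ t' ∈ (c (k₁ + t')).F.support) ∧
        cornerTraj (fun s => j (k₁ + s)) q E₀ t = E := by
  induction t with
  | zero =>
    intro E hE
    refine ⟨E, hE, fun t' ht' => ?_, rfl⟩
    obtain rfl : t' = 0 := Nat.le_zero.mp ht'
    exact hE
  | succ t ih =>
    intro E hE
    have hstep : c (k₁ + (t + 1)) = CentreBlowup.step q Finset.univ (j (k₁ + t)) 0 (c (k₁ + t)) := by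
      rw [show k₁ + (t + 1) = k₁ + t + 1 by ring, (hw (k₁ + t)).2.2.2.2, hcorner (k₁ + t) (by omega)]
    rw [hstep] at hE
    obtain ⟨e, he, heE⟩ := exists_of_mem_support_step_zero (j (k₁ + t)) (c (k₁ + t)) hE
    obtain ⟨E₀, hE₀, hanc, htr⟩ := ih e he
    have hnew : cornerTraj (fun s => j (k₁ + s)) q E₀ (t + 1) = E := by
      rw [cornerTraj_succ_eq_chartExponent, htr, heE]
    refine ⟨E₀, hE₀, fun t' ht' => ?_, hnew⟩
    rcases Nat.lt_or_ge t' (t + 1) with hlt | hge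
    · exact hanc t' (Nat.lt_succ_iff.mp hlt)
    · obtain rfl : t' = t + 1 := le_antisymm ht' hge
      rw [hnew, hstep]
      exact hE

/-! ## 2. The contradiction engine and the two / three letter stretches -/

/-- **THE CONTRADICTION ENGINE.**  On an isolated witnessed `Step0 q` chain that is pure-corner from `k₁`, if for some letter `i₀` every
monomial of `F_{k₁}` whose whole corner trajectory is present has its order along the `x_{i₀}`-axis eventually `≥ q`, contradiction: the
`x_{i₀}`-axis must stay non-`q`-fold at every state, `F_{k₁}` is finite, and one ancestor would serve infinitely often. [OURS]
[cite: CossartJannsenSaito2020, Lemma 13.2, Thm. 13.7] -/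
theorem pureCorner_contra (q : ℕ) {c : ℕ → State K} {j : ℕ → Fin 4} {b : ℕ → Fin 4 → K}
    (hiso : ∀ k, IsIsolated q (c k).F) (hw : FreeTail.IsWitnessedChain q c j b) {k₁ : ℕ}
    (hcorner : ∀ k, k₁ ≤ k → b k = 0) (i₀ : Fin 4)
    (hdrift : ∀ E₀ ∈ (c k₁).F.support, (∀ t, cornerTraj (fun s => j (k₁ + s)) q E₀ t ∈ (c (k₁ + t)).F.support) →
      ∃ T, ∀ t, T ≤ t → q ≤ degIn (Finset.univ.erase i₀) (cornerTraj (fun s => j (k₁ + s)) q E₀ t)) : False := by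
  classical
  set j' : ℕ → Fin 4 := fun s => j (k₁ + s) with hj'
  -- at every time a present witness with a fully present ancestry
  have hwit : ∀ T : ℕ, ∃ E₀ : ↥((c k₁).F.support),
      (∀ t', t' ≤ T → cornerTraj j' q E₀.1 t' ∈ (c (k₁ + t')).F.support) ∧
        degIn (Finset.univ.erase i₀) (cornerTraj j' q E₀.1 T) < q := by
    intro T
    obtain ⟨E, hE, hlt⟩ := exists_degIn_lt_of_ordAlong_lt (ordAlong_erase_lt_of_isIsolated (hiso (k₁ + T)) i₀)
    obtain ⟨E₀, hE₀, hanc, htr⟩ := pureCorner_ancestor q hw hcorner T E hE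
    exact ⟨⟨E₀, hE₀⟩, hanc, by rw [htr]; exact hlt⟩
  choose A hA using hwit
  -- pigeonhole: one ancestor serves infinitely often
  obtain ⟨E₀, hinf⟩ := Finite.exists_infinite_fiber A
  have hinf' : (A ⁻¹' {E₀}).Infinite := Set.infinite_coe_iff.mp hinf
  -- it is present for ever
  have hpres : ∀ t, cornerTraj j' q E₀.1 t ∈ (c (k₁ + t)).F.support := by
    intro t
    obtain ⟨T, hT, htT⟩ := hinf'.exists_gt t
    have hAT : A T = E₀ := hT
    have h := (hA T).1 t htT.le
    rwa [hAT] at h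
  obtain ⟨T₀, hT₀⟩ := hdrift E₀.1 E₀.2 hpres
  obtain ⟨T, hT, hTT⟩ := hinf'.exists_gt T₀
  have hAT : A T = E₀ := hT
  have h1 := (hA T).2
  rw [hAT] at h1
  have h2 := hT₀ T hTT.le
  omega

/-- The axis data of a present trajectory obey the drift dynamics (a present monomial has degree `≥ q`). [OURS · bookkeeping] -/
theorem pureCorner_axis_dynamics (q : ℕ) {c : ℕ → State K} {j : ℕ → Fin 4} {b : ℕ → Fin 4 → K}
    (hw : FreeTail.IsWitnessedChain q c j b) {k₁ : ℕ} {E₀ : Fin 4 →₀ ℕ}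
    (hpres : ∀ t, cornerTraj (fun s => j (k₁ + s)) q E₀ t ∈ (c (k₁ + t)).F.support) (t : ℕ) (l : Fin 4) :
    (l = j (k₁ + t) →
      degIn (Finset.univ.erase l) (cornerTraj (fun s => j (k₁ + s)) q E₀ (t + 1)) =
        degIn (Finset.univ.erase l) (cornerTraj (fun s => j (k₁ + s)) q E₀ t)) ∧
    (l ≠ j (k₁ + t) →
      degIn (Finset.univ.erase l) (cornerTraj (fun s => j (k₁ + s)) q E₀ (t + 1)) + q =
        degIn (Finset.univ.erase l) (cornerTraj (fun s => j (k₁ + s)) q E₀ t) +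
          degIn (Finset.univ.erase (j (k₁ + t))) (cornerTraj (fun s => j (k₁ + s)) q E₀ t)) := by
  have hq : q ≤ (cornerTraj (fun s => j (k₁ + s)) q E₀ t).degree := by
    have h := le_ordAlong_iff.mp (hw (k₁ + t)).1 _ (hpres t)
    rw [degIn_univ] at h
    exact_mod_cast h
  refine ⟨fun h => ?_, fun h => ?_⟩
  · rw [cornerTraj_succ_eq_chartExponent, h]
    exact degIn_erase_chartExponent_self q _ hq
  · rw [cornerTraj_succ_eq_chartExponent]
    exact degIn_erase_chartExponent_of_ne q h hq

/-- **NO PURE-CORNER STRETCH ON TWO LETTERS.**  An isolated witnessed `Step0 q` chain cannot be pure-corner from `k₁` on with all its charts in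
`{a, a′}` and both letters charted infinitely often. (No hypothesis on shade, weights or cone: the `q`-free successor of the p-5 g3 window game
`no_pureCorner_frame_tail`.) [OURS] [cite: CossartJannsenSaito2020, Lemma 13.4, Thm. 13.7] -/
theorem no_pureCorner_stretch_two (q : ℕ) {c : ℕ → State K} {j : ℕ → Fin 4} {b : ℕ → Fin 4 → K}
    (hiso : ∀ k, IsIsolated q (c k).F) (hw : FreeTail.IsWitnessedChain q c j b) {k₁ : ℕ}
    (hcorner : ∀ k, k₁ ≤ k → b k = 0) {a a' : Fin 4} (haa : a ≠ a') (hj : ∀ k, k₁ ≤ k → j k = a ∨ j k = a')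
    (ha : ∀ T, ∃ k, T ≤ k ∧ j k = a) (ha' : ∀ T, ∃ k, T ≤ k ∧ j k = a') : False := by
  refine pureCorner_contra q hiso hw hcorner a fun E₀ _ hpres => ?_
  set δ : ℕ → Fin 4 → ℤ := fun t l =>
    (degIn (Finset.univ.erase l) (cornerTraj (fun s => j (k₁ + s)) q E₀ t) : ℤ) - q with hδ
  have hdyn := fun t l => pureCorner_axis_dynamics q hw hpres t l
  obtain ⟨T, hT⟩ := pureCorner_drift_two (j := fun s => j (k₁ + s)) (δ := δ) haa
    (fun t => hj (k₁ + t) (by omega))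
    (fun T => by obtain ⟨k, hk, hjk⟩ := ha (k₁ + T); exact ⟨k - k₁, by omega, by rwa [show k₁ + (k - k₁) = k by omega]⟩)
    (fun T => by obtain ⟨k, hk, hjk⟩ := ha' (k₁ + T); exact ⟨k - k₁, by omega, by rwa [show k₁ + (k - k₁) = k by omega]⟩)
    (fun t => by simp only [hδ]; rw [(hdyn t _).1 rfl])
    (fun t l hl => by simp only [hδ]; have h := (hdyn t l).2 hl; linarith)
    (B := -q) (fun t => by simp only [hδ]; constructor <;> linarith)
  refine ⟨T, fun t ht => ?_⟩
  have h := (hT t ht).1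
  simp only [hδ] at h
  exact_mod_cast (by linarith : (q : ℤ) ≤ degIn (Finset.univ.erase a) (cornerTraj (fun s => j (k₁ + s)) q E₀ t))

/-- **NO PURE-CORNER STRETCH ON THREE LETTERS.**  An isolated witnessed `Step0 q` chain cannot be pure-corner from `k₁` on with all its charts in
`{a, b′, c′}` and the three letters each charted infinitely often. [OURS] [cite: CossartJannsenSaito2020, Lemma 13.4, Thm. 13.7] -/
theorem no_pureCorner_stretch_three (q : ℕ) {c : ℕ → State K} {j : ℕ → Fin 4} {b : ℕ → Fin 4 → K}
    (hiso : ∀ k, IsIsolated q (c k).F) (hw : FreeTail.IsWitnessedChain q c j b) {k₁ : ℕ}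
    (hcorner : ∀ k, k₁ ≤ k → b k = 0) {a a' a'' : Fin 4} (h1 : a ≠ a') (h2 : a ≠ a'') (h3 : a' ≠ a'')
    (hj : ∀ k, k₁ ≤ k → j k = a ∨ j k = a' ∨ j k = a'') (ha : ∀ T, ∃ k, T ≤ k ∧ j k = a)
    (ha' : ∀ T, ∃ k, T ≤ k ∧ j k = a') (ha'' : ∀ T, ∃ k, T ≤ k ∧ j k = a'') : False := by
  refine pureCorner_contra q hiso hw hcorner a fun E₀ _ hpres => ?_
  set δ : ℕ → Fin 4 → ℤ := fun t l =>
    (degIn (Finset.univ.erase l) (cornerTraj (fun s => j (k₁ + s)) q E₀ t) : ℤ) - q with hδ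
  have hdyn := fun t l => pureCorner_axis_dynamics q hw hpres t l
  obtain ⟨T, hT⟩ := pureCorner_drift_three (j := fun s => j (k₁ + s)) (δ := δ) h1 h2 h3
    (fun t => hj (k₁ + t) (by omega))
    (fun T => by obtain ⟨k, hk, hjk⟩ := ha (k₁ + T); exact ⟨k - k₁, by omega, by rwa [show k₁ + (k - k₁) = k by omega]⟩)
    (fun T => by obtain ⟨k, hk, hjk⟩ := ha' (k₁ + T); exact ⟨k - k₁, by omega, by rwa [show k₁ + (k - k₁) = k by omega]⟩)
    (fun T => by obtain ⟨k, hk, hjk⟩ := ha'' (k₁ + T); exact ⟨k - k₁, by omega, by rwa [show k₁ + (k - k₁) = k by omega]⟩)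
    (fun t => by simp only [hδ]; rw [(hdyn t _).1 rfl])
    (fun t l hl => by simp only [hδ]; have h := (hdyn t l).2 hl; linarith)
    (B := -q) (fun t => by simp only [hδ]; refine ⟨?_, ?_, ?_⟩ <;> linarith)
  refine ⟨T, fun t ht => ?_⟩
  have h := (hT t ht).1
  simp only [hδ] at h
  exact_mod_cast (by linarith : (q : ℤ) ≤ degIn (Finset.univ.erase a) (cornerTraj (fun s => j (k₁ + s)) q E₀ t))

/-- **NO PURE-CORNER STRETCH ON FOUR LETTERS.**  An isolated witnessed `Step0 q` chain cannot be pure-corner from `k₁` on with all four letters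
charted infinitely often. [OURS] [cite: CossartJannsenSaito2020, Lemma 13.4, Thm. 13.7] -/
theorem no_pureCorner_stretch_four (q : ℕ) {c : ℕ → State K} {j : ℕ → Fin 4} {b : ℕ → Fin 4 → K}
    (hiso : ∀ k, IsIsolated q (c k).F) (hw : FreeTail.IsWitnessedChain q c j b) {k₁ : ℕ}
    (hcorner : ∀ k, k₁ ≤ k → b k = 0) {a₁ a₂ a₃ a₄ : Fin 4} (h1 : a₁ ≠ a₂) (h2 : a₁ ≠ a₃) (h3 : a₁ ≠ a₄) (h4 : a₂ ≠ a₃)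
    (h5 : a₂ ≠ a₄) (h6 : a₃ ≠ a₄) (hj : ∀ k, k₁ ≤ k → j k = a₁ ∨ j k = a₂ ∨ j k = a₃ ∨ j k = a₄)
    (ha₁ : ∀ T, ∃ k, T ≤ k ∧ j k = a₁) (ha₂ : ∀ T, ∃ k, T ≤ k ∧ j k = a₂) (ha₃ : ∀ T, ∃ k, T ≤ k ∧ j k = a₃)
    (ha₄ : ∀ T, ∃ k, T ≤ k ∧ j k = a₄) : False := by
  refine pureCorner_contra q hiso hw hcorner a₁ fun E₀ _ hpres => ?_
  set δ : ℕ → Fin 4 → ℤ := fun t l =>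
    (degIn (Finset.univ.erase l) (cornerTraj (fun s => j (k₁ + s)) q E₀ t) : ℤ) - q with hδ
  have hdyn := fun t l => pureCorner_axis_dynamics q hw hpres t l
  obtain ⟨T, hT⟩ := pureCorner_drift_four (j := fun s => j (k₁ + s)) (δ := δ) h1 h2 h3 h4 h5 h6
    (fun t => hj (k₁ + t) (by omega))
    (fun T => by obtain ⟨k, hk, hjk⟩ := ha₁ (k₁ + T); exact ⟨k - k₁, by omega, by rwa [show k₁ + (k - k₁) = k by omega]⟩)
    (fun T => by obtain ⟨k, hk, hjk⟩ := ha₂ (k₁ + T); exact ⟨k - k₁, by omega, by rwa [show k₁ + (k - k₁) = k by omega]⟩)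
    (fun T => by obtain ⟨k, hk, hjk⟩ := ha₃ (k₁ + T); exact ⟨k - k₁, by omega, by rwa [show k₁ + (k - k₁) = k by omega]⟩)
    (fun T => by obtain ⟨k, hk, hjk⟩ := ha₄ (k₁ + T); exact ⟨k - k₁, by omega, by rwa [show k₁ + (k - k₁) = k by omega]⟩)
    (fun t => by simp only [hδ]; rw [(hdyn t _).1 rfl])
    (fun t l hl => by simp only [hδ]; have h := (hdyn t l).2 hl; linarith)
    (B := -q) (fun t => by simp only [hδ]; refine ⟨?_, ?_, ?_, ?_⟩ <;> linarith)
  refine ⟨T, fun t ht => ?_⟩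
  have h := (hT t ht).1
  simp only [hδ] at h
  exact_mod_cast (by linarith : (q : ℤ) ≤ degIn (Finset.univ.erase a₁) (cornerTraj (fun s => j (k₁ + s)) q E₀ t))

/-! ## 3. No pure-corner tail -/

/-- **NO PURE-CORNER TAIL (every prime `p`).**  Over a field of characteristic `p` there is no witnessed `Step0 p` chain of ISOLATED states
whose steps are pure corners (`b k = 0`) from some index `k₀` on.  (The free-tail theorem gives two letters charted infinitely often; the letters
charted finitely often are dropped; then `no_pureCorner_stretch_two/three/four` by the number of letters charted infinitely often.)  No hypothesis
on the shade, the weights, the residual cone or divisibility. [OURS] [cite: CossartJannsenSaito2020, Lemma 13.2, Lemma 13.4, Thm. 13.7] -/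
theorem no_pureCorner_tail (p : ℕ) [Fact p.Prime] [CharP K p] {c : ℕ → State K} {j : ℕ → Fin 4} {b : ℕ → Fin 4 → K}
    (hc : ∀ k, IsIsolated p (c k).F ∧ Step0 p (c k) (c (k + 1))) (hw : FreeTail.IsWitnessedChain p c j b) {k₀ : ℕ}
    (hcorner : ∀ k, k₀ ≤ k → b k = 0) : False := by
  classical
  have hiso : ∀ k, IsIsolated p (c k).F := fun k => (hc k).1
  -- letters charted finitely often are eventually never charted
  have hsplit : ∀ i : Fin 4, ∃ T : ℕ, (∀ T', ∃ k, T' ≤ k ∧ j k = i) ∨ (∀ k, T ≤ k → j k ≠ i) := by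
    intro i
    by_cases h : ∀ T', ∃ k, T' ≤ k ∧ j k = i
    · exact ⟨0, Or.inl h⟩
    · push Not at h
      obtain ⟨T', hT'⟩ := h
      exact ⟨T', Or.inr fun k hk => hT' k hk⟩
  choose T hT using hsplit
  set k₁ : ℕ := k₀ + T 0 + T 1 + T 2 + T 3 with hk₁
  have hTle : ∀ i, T i ≤ k₁ := by
    intro i
    fin_cases i <;> simp [hk₁] <;> omega
  have hio : ∀ k, k₁ ≤ k → ∀ T', ∃ k', T' ≤ k' ∧ j k' = j k := by
    intro k hk
    rcases hT (j k) with h | h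
    · exact h
    · exact absurd rfl (h k ((hTle (j k)).trans hk))
  -- the letters charted infinitely often
  set Cinf : Finset (Fin 4) := Finset.univ.filter fun i => ∀ T', ∃ k, T' ≤ k ∧ j k = i with hCinf
  have hmemCinf : ∀ i, i ∈ Cinf ↔ ∀ T', ∃ k, T' ≤ k ∧ j k = i := fun i => by simp [hCinf]
  have hjmem : ∀ k, k₁ ≤ k → j k ∈ Cinf := fun k hk => (hmemCinf _).mpr (hio k hk)
  have hcard4 : Cinf.card ≤ 4 := by
    have h := Finset.card_le_univ Cinf
    rwa [Fintype.card_fin] at h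
  -- two letters charted infinitely often (a satellite step changes the chart)
  have hcard2 : 2 ≤ Cinf.card := by
    obtain ⟨m, hm, hsat⟩ := exists_satellite_ge p hc hw k₁
    have h1 : j m ∈ Cinf := hjmem m hm
    have h2 : j (m + 1) ∈ Cinf := hjmem (m + 1) (by omega)
    have hne : j (m + 1) ≠ j m := hsat.1
    calc 2 = ({j m, j (m + 1)} : Finset (Fin 4)).card := by rw [Finset.card_pair hne.symm]
      _ ≤ Cinf.card := Finset.card_le_card (by
          intro x hx
          simp only [Finset.mem_insert, Finset.mem_singleton] at hx
          rcases hx with rfl | rfl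
          · exact h1
          · exact h2)
  have hcorner₁ : ∀ k, k₁ ≤ k → b k = 0 := fun k hk => hcorner k (by omega)
  interval_cases hcd : Cinf.card
  · obtain ⟨a, a', haa, hCeq⟩ := Finset.card_eq_two.mp hcd
    have hmem : ∀ k, k₁ ≤ k → j k = a ∨ j k = a' := by
      intro k hk
      have h := hjmem k hk
      rw [hCeq] at h
      simpa using h
    exact no_pureCorner_stretch_two p hiso hw hcorner₁ haa hmem
      ((hmemCinf a).mp (by rw [hCeq]; simp)) ((hmemCinf a').mp (by rw [hCeq]; simp))
  · obtain ⟨a, a', a'', h1, h2, h3, hCeq⟩ := Finset.card_eq_three.mp hcd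
    have hmem : ∀ k, k₁ ≤ k → j k = a ∨ j k = a' ∨ j k = a'' := by
      intro k hk
      have h := hjmem k hk
      rw [hCeq] at h
      simpa using h
    exact no_pureCorner_stretch_three p hiso hw hcorner₁ h1 h2 h3 hmem
      ((hmemCinf a).mp (by rw [hCeq]; simp)) ((hmemCinf a').mp (by rw [hCeq]; simp))
      ((hmemCinf a'').mp (by rw [hCeq]; simp))
  · have hCeq : Cinf = Finset.univ := Finset.eq_univ_of_card Cinf (by rw [hcd, Fintype.card_fin])
    have hall : ∀ i : Fin 4, ∀ T', ∃ k, T' ≤ k ∧ j k = i := fun i =>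
      (hmemCinf i).mp (by rw [hCeq]; exact Finset.mem_univ i)
    have h4 : ∀ i : Fin 4, i = 0 ∨ i = 1 ∨ i = 2 ∨ i = 3 := by decide
    exact no_pureCorner_stretch_four p hiso hw hcorner₁ (a₁ := 0) (a₂ := 1) (a₃ := 2) (a₄ := 3) (by decide) (by decide)
      (by decide) (by decide) (by decide) (by decide) (fun k _ => h4 (j k)) (hall 0) (hall 1) (hall 2) (hall 3)

/-- **NO TRANSLATION-FREE POWER-CONE TAIL — the B-row wording (every prime `p`).**  A witnessed isolated `Step0 p` chain whose chart points vanish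
from some index on (`b k i = 0` for all `i`, `k ≥ k₀`) does not exist; in particular no constant-shade power-cone (`e_G = 3`) tail of OUR frame
is eventually translation-free, whatever its weights: every power-cone tail translates a letter at infinitely many steps, and the «frozen
pure-corner regime» of res-dim4-p-3's `powerCone_corner_frozen` is EMPTY. [OURS] [cite: CossartJannsenSaito2020, Thm. 3.14, Lemma 13.4, Thm. 13.7] -/
theorem no_translationFree_powerCone_tail (p : ℕ) [Fact p.Prime] [CharP K p] {c : ℕ → State K} {j : ℕ → Fin 4}
    {b : ℕ → Fin 4 → K} (hc : ∀ k, IsIsolated p (c k).F ∧ Step0 p (c k) (c (k + 1)))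
    (hw : FreeTail.IsWitnessedChain p c j b) {k₀ : ℕ} (hcorner : ∀ k, k₀ ≤ k → ∀ i, b k i = 0) : False :=
  no_pureCorner_tail p hc hw (k₀ := k₀) fun k hk => funext (hcorner k hk)

end ResCone

end Summit.ResolutionOfSingularities.ResolutionOfSingularities.Theorems.PIDim4

end
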